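import Mathlib.NumberTheory.Padics.PadicIntegers
import Mathlib.LinearAlgebra.Matrix.NonsingularInverse
import Mathlib.LinearAlgebra.Matrix.ToLin
import Mathlib.LinearAlgebra.Matrix.Notation
import Mathlib.Data.Matrix.Basic
import HarnessLib

/-!
# Transvection normal form modulo `p^m` over `ℤ_p`: a `2 × 2` matrix `M` with `M² ≡ 0 (mod p^m)`
# and `M ≢ 0 (mod p)` is `GL₂(ℤ_p)`-conjugate to `(0 1 | 0 0)` modulo `p^m`
# (cell `b2b-bsdres`, team n1011, ROUTE-1 §25.4 (c) / R1-41 "convention lemma", bridge (B1) core;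
# row T-B1, seat p09 GEN 4)

HONEST FRAMING (cell `b2b-bsdres`, run/shared/lean/b2b/bsd-rank1-residual/, verbatim in every
file): the goal of the cell is to DELETE the COMBINATION-SHAPED residual classes of the
Birch–Swinnerton-Dyer formula for ALL analytic-rank `≤ 1` elliptic curves over `ℚ` — "full BSD
formula for every rank `≤ 1` curve in class `C`" assembled STRICTLY from published theorems — so
that the rank-`≤ 1` remainder becomes exactly the CONSTRUCTION-SHAPED classes, which are TYPED
(missing-input `Prop`s), NOT attempted. This is not "finishing BSD". Team n1011 (N10/N11, the
additive block `X4 ∧ p = 3`): research route; TOOL theorems only (no definition, no named fact);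
nothing here is a class theorem, no label changes, nothing is booked.

## What and why

The (a′) chain of ROUTE-1 (R1-21 dictionary, R1-23 END THEOREM
`Assembly.padicValRat_le_of_certificate`) speaks of Kolyvagin LEVELS of a Kolyvagin datum whose
primes are Sakamoto's `τ`-class primes `frobeniusClassPrimes ρ S τ (p^m)` ("`Fr_q` conjugate to `τ`
in `Gal(ℚ(E[p^m], μ_{p^m})/ℚ)`", JTNB 36 (2024) §2), while the registers, scans and per-pair
records speak of primes `ℓ ≡ 1`, `a_ℓ ≡ 2 (mod p^m)` with cyclic `Ẽ(𝔽_ℓ)[p]`.  The passage (bridge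
(B1), file `KolyvaginPrimeFrobeniusClass.lean`) rests on the following piece of linear algebra,
r1's CONVENTION LEMMA (ROUTE-1 §25.4 (c)) in `p`-adic form: in `GL₂`, "unipotent with cyclic
cokernel of order `p^m`" is ONE conjugacy class modulo `p^m`.  Precisely, for
`M ∈ M₂(ℤ_p)` (think `M = ρ(σ) − 1` on `T_pE`):

* `Transvection.sq_eq_pow_smul_of_dvd_trace_of_dvd_det` — `p^m ∣ tr M` and `p^m ∣ det M` give
  `M² ≡ 0 (mod p^m)` (Cayley–Hamilton);
* `Transvection.exists_conj_eq_std_add` — **NORMAL FORM**: if `M² ≡ 0 (mod p^m)` (`m ≥ 1`) and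
  `M ≢ 0 (mod p)`, there is `P` with `det P ∈ ℤ_pˣ` and `P⁻¹ M P ≡ (0 1 | 0 0) (mod p^m)`
  (take `e` a standard basis vector with `f := M e ≢ 0 (mod p)`; then `M f = M² e ≡ 0`, and
  `(f, e)` is a basis because modulo `p` a relation `α f + β e = 0` gives `β f = 0` after applying
  `M`; in coordinates this is the observation that `M² ≡ 0` forces the OFF-diagonal entry of the
  column carrying a unit to be a unit);
* `Transvection.exists_conj_eq_add` / `exists_conj_one_add_eq_add` — **CONJUGACY**: two such `M₁`,
  `M₂` (resp. the unipotents `1 + M₁`, `1 + M₂`) are conjugate modulo `p^m` by a matrix with unit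
  determinant, with explicit two-sided inverse;
* `Transvection.exists_linearMap_conj_eq_add` — the same on a free `ℤ_p`-module with a basis
  indexed by `Fin 2` (the shape of `T_pE`), for `LinearMap`s.

Congruences are spelled `A = B + (p : ℤ_[p]) ^ m • C`, the currency of
`Kato2004/Condition1252.lean` (`exists_galoisRepTate_eq_add_smul_of_hasSurjectiveModNGaloisRep`).
Elementary; no source needed beyond Cayley–Hamilton. [folklore]
-/

noncomputable section

open scoped Classical
open Matrix

namespace Summit.BirchSwinnertonDyer.Rank1Residual.GaloisImage.Transvection

variable {p : ℕ} [hp : Fact p.Prime]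

/-! ### `ℤ_p` helpers -/

/-- A non-unit of `ℤ_p` is divisible by `p`. [folklore] -/
theorem p_dvd_of_not_isUnit {z : ℤ_[p]} (hz : ¬ IsUnit z) : (p : ℤ_[p]) ∣ z := by
  rw [PadicInt.isUnit_iff] at hz
  exact (PadicInt.norm_lt_one_iff_dvd z).mp (lt_of_le_of_ne (PadicInt.norm_le_one z) hz)

/-- A unit of `ℤ_p` is not divisible by `p`. [folklore] -/
theorem not_p_dvd_of_isUnit {z : ℤ_[p]} (hz : IsUnit z) : ¬ (p : ℤ_[p]) ∣ z := by
  intro h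
  have h1 : ‖z‖ < 1 := (PadicInt.norm_lt_one_iff_dvd z).mpr h
  rw [PadicInt.isUnit_iff] at hz
  exact absurd hz (ne_of_lt h1)

/-- `p ∣ z²` implies `p ∣ z` in `ℤ_p`. [folklore] -/
theorem p_dvd_of_p_dvd_mul_self {z : ℤ_[p]} (h : (p : ℤ_[p]) ∣ z * z) : (p : ℤ_[p]) ∣ z := by
  rcases (PadicInt.irreducible_p.prime.dvd_or_dvd h) with h | h <;> exact h

/-- For `1 ≤ m`, `p ∣ p^m`. [folklore] -/
theorem p_dvd_pow {m : ℕ} (hm : 1 ≤ m) : (p : ℤ_[p]) ∣ (p : ℤ_[p]) ^ m :=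
  dvd_pow_self _ (by omega)

/-! ### Cayley–Hamilton in degree two -/

/-- **`M² ≡ 0 (mod p^m)` from `tr M ≡ 0` and `det M ≡ 0 (mod p^m)`** (Cayley–Hamilton). [folklore] -/
theorem sq_eq_pow_smul_of_dvd_trace_of_dvd_det {m : ℕ} (M : Matrix (Fin 2) (Fin 2) ℤ_[p])
    (htr : (p : ℤ_[p]) ^ m ∣ M.trace) (hdet : (p : ℤ_[p]) ^ m ∣ M.det) :
    ∃ C : Matrix (Fin 2) (Fin 2) ℤ_[p], M * M = ((p : ℤ_[p]) ^ m) • C := by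
  obtain ⟨a, ha⟩ := htr
  obtain ⟨d, hd⟩ := hdet
  -- Cayley–Hamilton for `2 × 2` matrices (the tree's `Matrix.sq_eq_trace_smul_sub_det_fin_two`,
  -- re-derived entrywise to keep this file `Mathlib`-only)
  have hCH : M * M = M.trace • M - M.det • (1 : Matrix (Fin 2) (Fin 2) ℤ_[p]) := by
    rw [Matrix.trace_fin_two, Matrix.det_fin_two]
    ext i j
    fin_cases i <;> fin_cases j <;>
      simp [Matrix.mul_apply, Fin.sum_univ_two] <;> ring
  refine ⟨a • M - d • (1 : Matrix (Fin 2) (Fin 2) ℤ_[p]), ?_⟩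
  rw [hCH, ha, hd, smul_sub, smul_smul, smul_smul]

/-- If `1 + M` has trace `≡ 2` and determinant `≡ 1 (mod p^m)` then `M² ≡ 0 (mod p^m)` — the shape
in which a Frobenius at a Kolyvagin prime (`a_ℓ ≡ 2`, `ℓ ≡ 1`) and Sakamoto's `τ` arrive. [folklore] -/
theorem sq_eq_pow_smul_of_dvd_trace_sub_two_of_dvd_det_sub_one {m : ℕ}
    (M : Matrix (Fin 2) (Fin 2) ℤ_[p])
    (htr : (p : ℤ_[p]) ^ m ∣ (1 + M).trace - 2) (hdet : (p : ℤ_[p]) ^ m ∣ (1 + M).det - 1) :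
    ∃ C : Matrix (Fin 2) (Fin 2) ℤ_[p], M * M = ((p : ℤ_[p]) ^ m) • C := by
  have htr' : (p : ℤ_[p]) ^ m ∣ M.trace := by
    have h : (1 + M).trace - 2 = M.trace := by
      rw [Matrix.trace_add, Matrix.trace_one, Fintype.card_fin]; push_cast; ring
    rwa [h] at htr
  refine sq_eq_pow_smul_of_dvd_trace_of_dvd_det M htr' ?_
  have hdet1 : (1 + M).det = 1 + M.trace + M.det := by
    rw [Matrix.det_fin_two, Matrix.det_fin_two, Matrix.trace_fin_two]
    simp only [Matrix.add_apply, Matrix.one_apply_eq,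
      Matrix.one_apply_ne (show (0 : Fin 2) ≠ 1 by decide),
      Matrix.one_apply_ne (show (1 : Fin 2) ≠ 0 by decide)]
    ring
  have h : M.det = ((1 + M).det - 1) - M.trace := by rw [hdet1]; ring
  rw [h]
  exact dvd_sub hdet htr'

/-! ### The normal form -/

/-- `M ≢ 0 (mod p)` means some entry of `M` is a unit. [folklore] -/
theorem exists_isUnit_apply_of_ne_p_smul (M : Matrix (Fin 2) (Fin 2) ℤ_[p])
    (hne : ¬ ∃ C : Matrix (Fin 2) (Fin 2) ℤ_[p], M = (p : ℤ_[p]) • C) :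
    ∃ i j, IsUnit (M i j) := by
  by_contra h
  push Not at h
  apply hne
  choose c hc using fun i j => p_dvd_of_not_isUnit (h i j)
  refine ⟨Matrix.of fun i j => c i j, ?_⟩
  ext i j
  rw [Matrix.smul_apply, Matrix.of_apply, smul_eq_mul]
  exact hc i j

/-- Under `M² ≡ 0 (mod p)`, a unit ON the diagonal forces a unit OFF the diagonal in the same column:
if `M 0 0` is a unit then so is `M 1 0`, and if `M 1 1` is a unit then so is `M 0 1`
(`(M²)₀₀ = M₀₀² + M₀₁M₁₀`, `(M²)₁₁ = M₁₀M₀₁ + M₁₁²`). [folklore] -/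
theorem isUnit_offDiag_of_sq {m : ℕ} (hm : 1 ≤ m) (M : Matrix (Fin 2) (Fin 2) ℤ_[p])
    (hsq : ∃ C : Matrix (Fin 2) (Fin 2) ℤ_[p], M * M = ((p : ℤ_[p]) ^ m) • C)
    (hne : ¬ ∃ C : Matrix (Fin 2) (Fin 2) ℤ_[p], M = (p : ℤ_[p]) • C) :
    IsUnit (M 1 0) ∨ IsUnit (M 0 1) := by
  obtain ⟨C, hC⟩ := hsq
  have h00 : M 0 0 * M 0 0 + M 0 1 * M 1 0 = (p : ℤ_[p]) ^ m * C 0 0 := by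
    have := congrArg (fun X : Matrix (Fin 2) (Fin 2) ℤ_[p] => X 0 0) hC
    simpa [Matrix.mul_apply, Fin.sum_univ_two] using this
  have h11 : M 1 0 * M 0 1 + M 1 1 * M 1 1 = (p : ℤ_[p]) ^ m * C 1 1 := by
    have := congrArg (fun X : Matrix (Fin 2) (Fin 2) ℤ_[p] => X 1 1) hC
    simpa [Matrix.mul_apply, Fin.sum_univ_two] using this
  obtain ⟨i, j, hu⟩ := exists_isUnit_apply_of_ne_p_smul M hne
  by_contra hcon
  push Not at hcon
  obtain ⟨h10, h01⟩ := hcon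
  have hd10 := p_dvd_of_not_isUnit h10
  have hd01 := p_dvd_of_not_isUnit h01
  have hpm : (p : ℤ_[p]) ∣ (p : ℤ_[p]) ^ m := p_dvd_pow hm
  fin_cases i <;> fin_cases j
  · -- `M 0 0` unit ⟹ `p ∣ M 0 0 ^ 2`, contradiction
    have h : (p : ℤ_[p]) ∣ M 0 0 * M 0 0 := by
      have h2 : M 0 0 * M 0 0 = (p : ℤ_[p]) ^ m * C 0 0 - M 0 1 * M 1 0 := by rw [← h00]; ring
      rw [h2]
      exact dvd_sub (dvd_mul_of_dvd_left hpm _) (dvd_mul_of_dvd_right hd10 _)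
    exact not_p_dvd_of_isUnit hu (p_dvd_of_p_dvd_mul_self h)
  · exact h01 hu
  · exact h10 hu
  · have h : (p : ℤ_[p]) ∣ M 1 1 * M 1 1 := by
      have h2 : M 1 1 * M 1 1 = (p : ℤ_[p]) ^ m * C 1 1 - M 1 0 * M 0 1 := by rw [← h11]; ring
      rw [h2]
      exact dvd_sub (dvd_mul_of_dvd_left hpm _) (dvd_mul_of_dvd_left hd10 _)
    exact not_p_dvd_of_isUnit hu (p_dvd_of_p_dvd_mul_self h)

/-- **NORMAL FORM.** For `M ∈ M₂(ℤ_p)` with `M² ≡ 0 (mod p^m)`, `m ≥ 1`, and `M ≢ 0 (mod p)` there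
is `P ∈ M₂(ℤ_p)` with `det P ∈ ℤ_pˣ` and `P⁻¹ M P ≡ (0 1 | 0 0) (mod p^m)`.  With `M = ρ(σ) − 1`
this says: `σ` acts on `T_pE/p^m` as the standard transvection `(1 1 | 0 1)` in a suitable
`ℤ_p`-basis (r1's convention lemma, ROUTE-1 §25.4 (c)). [folklore] -/
theorem exists_conj_eq_std_add {m : ℕ} (hm : 1 ≤ m) (M : Matrix (Fin 2) (Fin 2) ℤ_[p])
    (hsq : ∃ C : Matrix (Fin 2) (Fin 2) ℤ_[p], M * M = ((p : ℤ_[p]) ^ m) • C)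
    (hne : ¬ ∃ C : Matrix (Fin 2) (Fin 2) ℤ_[p], M = (p : ℤ_[p]) • C) :
    ∃ (P : Matrix (Fin 2) (Fin 2) ℤ_[p]) (_ : IsUnit P.det) (C : Matrix (Fin 2) (Fin 2) ℤ_[p]),
      P⁻¹ * M * P = (!![0, 1; 0, 0] : Matrix (Fin 2) (Fin 2) ℤ_[p]) + ((p : ℤ_[p]) ^ m) • C := by
  obtain ⟨C, hC⟩ := id hsq
  -- entries of `M² = p^m C`
  have hsq' : ∀ i j, (M * M) i j = (p : ℤ_[p]) ^ m * C i j := fun i j => by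
    rw [hC, Matrix.smul_apply, smul_eq_mul]
  have e00 : M 0 0 * M 0 0 + M 0 1 * M 1 0 = (p : ℤ_[p]) ^ m * C 0 0 := by
    simpa [Matrix.mul_apply, Fin.sum_univ_two] using hsq' 0 0
  have e01 : M 0 0 * M 0 1 + M 0 1 * M 1 1 = (p : ℤ_[p]) ^ m * C 0 1 := by
    simpa [Matrix.mul_apply, Fin.sum_univ_two] using hsq' 0 1
  have e10 : M 1 0 * M 0 0 + M 1 1 * M 1 0 = (p : ℤ_[p]) ^ m * C 1 0 := by
    simpa [Matrix.mul_apply, Fin.sum_univ_two] using hsq' 1 0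
  have e11 : M 1 0 * M 0 1 + M 1 1 * M 1 1 = (p : ℤ_[p]) ^ m * C 1 1 := by
    simpa [Matrix.mul_apply, Fin.sum_univ_two] using hsq' 1 1
  rcases isUnit_offDiag_of_sq hm M hsq hne with hc | hb
  · -- basis `(f, e)` with `e = e₀`, `f = M e₀ = (M₀₀, M₁₀)`: `P = (M₀₀ 1 | M₁₀ 0)`, `det P = -M₁₀`
    let P : Matrix (Fin 2) (Fin 2) ℤ_[p] := !![M 0 0, 1; M 1 0, 0]
    have hdetP : P.det = -M 1 0 := by simp [P, Matrix.det_fin_two]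
    have hPu : IsUnit P.det := by rw [hdetP]; exact hc.neg
    -- `M P = P (!![0, 1; 0, 0] : Matrix (Fin 2) (Fin 2) ℤ_[p]) + p^m X`
    let X : Matrix (Fin 2) (Fin 2) ℤ_[p] := !![C 0 0, 0; C 1 0, 0]
    have hMP : M * P = P * (!![0, 1; 0, 0] : Matrix (Fin 2) (Fin 2) ℤ_[p]) + ((p : ℤ_[p]) ^ m) • X := by
      ext i j
      fin_cases i <;> fin_cases j
      · simp [P, X, Matrix.mul_apply, Fin.sum_univ_two]; linear_combination e00
      · simp [P, X, Matrix.mul_apply, Fin.sum_univ_two]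
      · simp [P, X, Matrix.mul_apply, Fin.sum_univ_two]; linear_combination e10
      · simp [P, X, Matrix.mul_apply, Fin.sum_univ_two]
    refine ⟨P, hPu, P⁻¹ * X, ?_⟩
    calc P⁻¹ * M * P = P⁻¹ * (M * P) := by rw [Matrix.mul_assoc]
      _ = P⁻¹ * (P * (!![0, 1; 0, 0] : Matrix (Fin 2) (Fin 2) ℤ_[p]) + ((p : ℤ_[p]) ^ m) • X) := by rw [hMP]
      _ = P⁻¹ * P * (!![0, 1; 0, 0] : Matrix (Fin 2) (Fin 2) ℤ_[p]) + ((p : ℤ_[p]) ^ m) • (P⁻¹ * X) := by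
          rw [Matrix.mul_add, Matrix.mul_smul, Matrix.mul_assoc]
      _ = (!![0, 1; 0, 0] : Matrix (Fin 2) (Fin 2) ℤ_[p]) + ((p : ℤ_[p]) ^ m) • (P⁻¹ * X) := by rw [Matrix.nonsing_inv_mul P hPu, Matrix.one_mul]
  · -- basis `(f, e)` with `e = e₁`, `f = M e₁ = (M₀₁, M₁₁)`: `P = (M₀₁ 0 | M₁₁ 1)`, `det P = M₀₁`
    let P : Matrix (Fin 2) (Fin 2) ℤ_[p] := !![M 0 1, 0; M 1 1, 1]
    have hdetP : P.det = M 0 1 := by simp [P, Matrix.det_fin_two]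
    have hPu : IsUnit P.det := by rw [hdetP]; exact hb
    let X : Matrix (Fin 2) (Fin 2) ℤ_[p] := !![C 0 1, 0; C 1 1, 0]
    have hMP : M * P = P * (!![0, 1; 0, 0] : Matrix (Fin 2) (Fin 2) ℤ_[p]) + ((p : ℤ_[p]) ^ m) • X := by
      ext i j
      fin_cases i <;> fin_cases j
      · simp [P, X, Matrix.mul_apply, Fin.sum_univ_two]; linear_combination e01
      · simp [P, X, Matrix.mul_apply, Fin.sum_univ_two]
      · simp [P, X, Matrix.mul_apply, Fin.sum_univ_two]; linear_combination e11
      · simp [P, X, Matrix.mul_apply, Fin.sum_univ_two]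
    refine ⟨P, hPu, P⁻¹ * X, ?_⟩
    calc P⁻¹ * M * P = P⁻¹ * (M * P) := by rw [Matrix.mul_assoc]
      _ = P⁻¹ * (P * (!![0, 1; 0, 0] : Matrix (Fin 2) (Fin 2) ℤ_[p]) + ((p : ℤ_[p]) ^ m) • X) := by rw [hMP]
      _ = P⁻¹ * P * (!![0, 1; 0, 0] : Matrix (Fin 2) (Fin 2) ℤ_[p]) + ((p : ℤ_[p]) ^ m) • (P⁻¹ * X) := by
          rw [Matrix.mul_add, Matrix.mul_smul, Matrix.mul_assoc]
      _ = (!![0, 1; 0, 0] : Matrix (Fin 2) (Fin 2) ℤ_[p]) + ((p : ℤ_[p]) ^ m) • (P⁻¹ * X) := by rw [Matrix.nonsing_inv_mul P hPu, Matrix.one_mul]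

/-! ### Conjugacy -/

/-- **CONJUGACY modulo `p^m`.** Two matrices `M₁, M₂ ∈ M₂(ℤ_p)` with `Mᵢ² ≡ 0 (mod p^m)`
(`m ≥ 1`) and `Mᵢ ≢ 0 (mod p)` are conjugate modulo `p^m`: there are `Q, Q'` with `Q Q' = Q' Q = 1`
and `Q M₁ Q' ≡ M₂ (mod p^m)`. [folklore] -/
theorem exists_conj_eq_add {m : ℕ} (hm : 1 ≤ m) (M₁ M₂ : Matrix (Fin 2) (Fin 2) ℤ_[p])
    (hsq₁ : ∃ C : Matrix (Fin 2) (Fin 2) ℤ_[p], M₁ * M₁ = ((p : ℤ_[p]) ^ m) • C)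
    (hne₁ : ¬ ∃ C : Matrix (Fin 2) (Fin 2) ℤ_[p], M₁ = (p : ℤ_[p]) • C)
    (hsq₂ : ∃ C : Matrix (Fin 2) (Fin 2) ℤ_[p], M₂ * M₂ = ((p : ℤ_[p]) ^ m) • C)
    (hne₂ : ¬ ∃ C : Matrix (Fin 2) (Fin 2) ℤ_[p], M₂ = (p : ℤ_[p]) • C) :
    ∃ (Q Q' : Matrix (Fin 2) (Fin 2) ℤ_[p]) (C : Matrix (Fin 2) (Fin 2) ℤ_[p]),
      Q * Q' = 1 ∧ Q' * Q = 1 ∧ Q * M₁ * Q' = M₂ + ((p : ℤ_[p]) ^ m) • C := by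
  obtain ⟨P₁, hP₁, C₁, h₁⟩ := exists_conj_eq_std_add hm M₁ hsq₁ hne₁
  obtain ⟨P₂, hP₂, C₂, h₂⟩ := exists_conj_eq_std_add hm M₂ hsq₂ hne₂
  -- `Mᵢ = Pᵢ (J + p^m Cᵢ) Pᵢ⁻¹`
  have hM₁ : M₁ = P₁ * ((!![0, 1; 0, 0] : Matrix (Fin 2) (Fin 2) ℤ_[p]) + ((p : ℤ_[p]) ^ m) • C₁) * P₁⁻¹ := by
    rw [← h₁, ← Matrix.mul_assoc, ← Matrix.mul_assoc, Matrix.mul_nonsing_inv P₁ hP₁,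
      Matrix.one_mul, Matrix.mul_assoc, Matrix.mul_nonsing_inv P₁ hP₁, Matrix.mul_one]
  have hJ₂ : P₂ * (!![0, 1; 0, 0] : Matrix (Fin 2) (Fin 2) ℤ_[p]) * P₂⁻¹ = M₂ - ((p : ℤ_[p]) ^ m) • (P₂ * C₂ * P₂⁻¹) := by
    have h : P₂ * (P₂⁻¹ * M₂ * P₂) * P₂⁻¹ = M₂ := by
      rw [← Matrix.mul_assoc, ← Matrix.mul_assoc, Matrix.mul_nonsing_inv P₂ hP₂, Matrix.one_mul,
        Matrix.mul_assoc, Matrix.mul_nonsing_inv P₂ hP₂, Matrix.mul_one]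
    rw [h₂, Matrix.mul_add, Matrix.add_mul, Matrix.mul_smul, Matrix.smul_mul] at h
    rw [← h]; abel
  refine ⟨P₂ * P₁⁻¹, P₁ * P₂⁻¹, P₂ * C₁ * P₂⁻¹ - P₂ * C₂ * P₂⁻¹, ?_, ?_, ?_⟩
  · rw [Matrix.mul_assoc, ← Matrix.mul_assoc P₁⁻¹, Matrix.nonsing_inv_mul P₁ hP₁, Matrix.one_mul,
      Matrix.mul_nonsing_inv P₂ hP₂]
  · rw [Matrix.mul_assoc, ← Matrix.mul_assoc P₂⁻¹, Matrix.nonsing_inv_mul P₂ hP₂, Matrix.one_mul,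
      Matrix.mul_nonsing_inv P₁ hP₁]
  · -- `Q M₁ Q' = P₂ (J + p^m C₁) P₂⁻¹`
    have h : P₂ * P₁⁻¹ * M₁ * (P₁ * P₂⁻¹) = P₂ * ((!![0, 1; 0, 0] : Matrix (Fin 2) (Fin 2) ℤ_[p]) + ((p : ℤ_[p]) ^ m) • C₁) * P₂⁻¹ := by
      rw [hM₁]
      simp only [← Matrix.mul_assoc]
      rw [Matrix.mul_assoc (P₂ * P₁⁻¹ * P₁ * ((!![0, 1; 0, 0] : Matrix (Fin 2) (Fin 2) ℤ_[p]) + (p : ℤ_[p]) ^ m • C₁)) P₁⁻¹ P₁,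
        Matrix.nonsing_inv_mul P₁ hP₁, Matrix.mul_one, Matrix.mul_assoc P₂ P₁⁻¹ P₁,
        Matrix.nonsing_inv_mul P₁ hP₁, Matrix.mul_one]
    rw [h, Matrix.mul_add, Matrix.add_mul, hJ₂, Matrix.mul_smul, Matrix.smul_mul, smul_sub]
    abel

/-- **CONJUGACY of the unipotents `1 + M₁`, `1 + M₂` modulo `p^m`** (same hypotheses): there are
`Q, Q'` inverse to each other with `Q (1 + M₁) Q' ≡ 1 + M₂ (mod p^m)`.  This is the form used for
`ρ(φ)`, `ρ(τ)` on `T_pE`. [folklore] -/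
theorem exists_conj_one_add_eq_add {m : ℕ} (hm : 1 ≤ m) (M₁ M₂ : Matrix (Fin 2) (Fin 2) ℤ_[p])
    (hsq₁ : ∃ C : Matrix (Fin 2) (Fin 2) ℤ_[p], M₁ * M₁ = ((p : ℤ_[p]) ^ m) • C)
    (hne₁ : ¬ ∃ C : Matrix (Fin 2) (Fin 2) ℤ_[p], M₁ = (p : ℤ_[p]) • C)
    (hsq₂ : ∃ C : Matrix (Fin 2) (Fin 2) ℤ_[p], M₂ * M₂ = ((p : ℤ_[p]) ^ m) • C)
    (hne₂ : ¬ ∃ C : Matrix (Fin 2) (Fin 2) ℤ_[p], M₂ = (p : ℤ_[p]) • C) :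
    ∃ (Q Q' : Matrix (Fin 2) (Fin 2) ℤ_[p]) (C : Matrix (Fin 2) (Fin 2) ℤ_[p]),
      Q * Q' = 1 ∧ Q' * Q = 1 ∧ Q * (1 + M₁) * Q' = (1 + M₂) + ((p : ℤ_[p]) ^ m) • C := by
  obtain ⟨Q, Q', C, hQ, hQ', h⟩ := exists_conj_eq_add hm M₁ M₂ hsq₁ hne₁ hsq₂ hne₂
  refine ⟨Q, Q', C, hQ, hQ', ?_⟩
  rw [Matrix.mul_add, Matrix.add_mul, Matrix.mul_one, hQ, h, add_assoc]

/-! ### The same for linear maps of a free `ℤ_p`-module with a basis indexed by `Fin 2` -/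

/-- **CONJUGACY for endomorphisms.**  Let `T` be a `ℤ_p`-module with a basis `b` indexed by `Fin 2`
and `A₁, A₂` endomorphisms such that `Mᵢ := [Aᵢ]_b − 1` satisfy `Mᵢ² ≡ 0 (mod p^m)` (`m ≥ 1`) and
`Mᵢ ≢ 0 (mod p)`.  Then there are mutually inverse endomorphisms `B, B'` with
`B ∘ A₁ ∘ B' = A₂ + p^m C`.  (Transport of `exists_conj_one_add_eq_add` along
`LinearMap.toMatrix b b`.) [folklore] -/
theorem exists_linearMap_conj_eq_add {T : Type*} [AddCommGroup T] [Module ℤ_[p] T]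
    (b : Module.Basis (Fin 2) ℤ_[p] T) {m : ℕ} (hm : 1 ≤ m) (A₁ A₂ : T →ₗ[ℤ_[p]] T)
    (hsq₁ : ∃ C : Matrix (Fin 2) (Fin 2) ℤ_[p],
      (LinearMap.toMatrix b b A₁ - 1) * (LinearMap.toMatrix b b A₁ - 1) = ((p : ℤ_[p]) ^ m) • C)
    (hne₁ : ¬ ∃ C : Matrix (Fin 2) (Fin 2) ℤ_[p], LinearMap.toMatrix b b A₁ - 1 = (p : ℤ_[p]) • C)
    (hsq₂ : ∃ C : Matrix (Fin 2) (Fin 2) ℤ_[p],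
      (LinearMap.toMatrix b b A₂ - 1) * (LinearMap.toMatrix b b A₂ - 1) = ((p : ℤ_[p]) ^ m) • C)
    (hne₂ : ¬ ∃ C : Matrix (Fin 2) (Fin 2) ℤ_[p], LinearMap.toMatrix b b A₂ - 1 = (p : ℤ_[p]) • C) :
    ∃ (B B' C : T →ₗ[ℤ_[p]] T), B * B' = 1 ∧ B' * B = 1 ∧
      B * A₁ * B' = A₂ + ((p : ℤ_[p]) ^ m) • C := by
  obtain ⟨Q, Q', C, hQ, hQ', h⟩ := exists_conj_one_add_eq_add hm _ _ hsq₁ hne₁ hsq₂ hne₂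
  rw [add_sub_cancel, add_sub_cancel] at h
  refine ⟨Matrix.toLin b b Q, Matrix.toLin b b Q', Matrix.toLin b b C, ?_, ?_, ?_⟩
  · rw [Module.End.mul_eq_comp, ← Matrix.toLin_mul b b b, hQ, Matrix.toLin_one]
    rfl
  · rw [Module.End.mul_eq_comp, ← Matrix.toLin_mul b b b, hQ', Matrix.toLin_one]
    rfl
  · have hA₁ : A₁ = Matrix.toLin b b (LinearMap.toMatrix b b A₁) := (Matrix.toLin_toMatrix b b A₁).symm
    have hA₂ : A₂ = Matrix.toLin b b (LinearMap.toMatrix b b A₂) := (Matrix.toLin_toMatrix b b A₂).symm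
    rw [hA₁, hA₂, Module.End.mul_eq_comp, Module.End.mul_eq_comp, ← Matrix.toLin_mul b b b,
      ← Matrix.toLin_mul b b b, h, map_add, map_smul]

end Summit.BirchSwinnertonDyer.Rank1Residual.GaloisImage.Transvection

end
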